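import Literature.Analysis.FluidPDE.ForcedFourierPicardWeighted
import Literature.Analysis.FluidPDE.FourierL2PicardCauchy
import HarnessLib

/-!
# Geometric convergence of the forced Picard scheme in every weighted sup norm

Fifth file of the FORCED twin of the weighted-`L²` Fourier-side construction of the local smooth
solution of the Navier–Stokes system (T. Tao, Anal. PDE 6 (2013) = arXiv:1108.1165, Thm. 5.4 (ii)
= arXiv Thm. 31 (ii), p. 18, with force; proof of Thm. 5.1 = arXiv Thm. 28, p. 16: "the nonlinear
map `u ↦ Φ(u)` … is a contraction on the ball"). Homogeneous twin: `FourierL2PicardCauchy`.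

Under the forced smallness condition (the hypotheses of `picard_uniform_bounds_forced'`: force
coefficients in the WIDE class — jointly measurable, continuous in time at each frequency, uniform
decay — the class of the Leray-projected transform of a Schwartz force), the
differences of consecutive forced Picard iterates `d_n = w_n - w_{n+1}`
(`w_n = picardIterForced c T a b n`) decay geometrically in the `e^{-λt}(1+‖ξ‖)^K`-weighted
`L²`-majorant sense for every `K` (`exists_geometric_weighted_majorant_diff_picardIterForced`:
`‖Q_n‖₂ ≤ b 2^{-n}`): since the forcing term does not depend on the unknown,
`d_{n+1} = duhamelIntegral c T w_{n+1} − duhamelIntegral c T w_n` is a difference of HOMOGENEOUS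
Duhamel integrals and the difference step of `FourierL2PicardDifference` applies verbatim, with the
`n`-uniform inputs of `ForcedFourierPicardWeighted`; only the base `d_0 = E_1 − E_0 = E_1 + F`
sees the force. Hence — Cauchy–Schwarz — **pointwise decay with every polynomial weight, uniformly
in time** (`exists_geometric_bound_diff_picardIterForced`, real form
`exists_geometric_norm_bound_diff_picardIterForced`: `(1+‖ξ‖)^K ‖w_{n+1}(t,ξ) - w_n(t,ξ)‖ ≤ B 2^{-n}`).
No definitions, no named facts.

## Mathlib / tree search

Tree (reused as black boxes): `exp_weight_enorm_duhamelIntegral_hsub_sub_le'`,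
`lintegral_diff_majorant_sq_le`, `diff_majorant_le` (`FourierL2PicardDifference`),
`lintegral_le_rpow_half_of_weight_sq_le` (`FourierL2PicardWeighted`); forced inputs
`exists_uniform_envelope_picardIterForced'`, `exists_uniform_hasDecay_picardIterForced'`,
`exists_uniform_weighted_majorant_picardIterForced'` (`ForcedFourierPicardWeighted`),
`class_picardIterForced` (`ForcedFourierPicardBounds`).

## References

* T. Tao, Anal. PDE 6 (2013) = arXiv:1108.1165, Thm. 5.4 (ii) = arXiv Thm. 31 (p. 18), proof of
  Thm. 5.1 = arXiv Thm. 28 (p. 16). [Tao2011]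
-/

noncomputable section

open MeasureTheory Real Set Filter Function intervalIntegral
open scoped ENNReal NNReal Convolution
open _root_.Topology

namespace Literature.Analysis.FluidPDE.FourierNS

/-! ### The Picard iterates only see the clamped time -/

section Clamp

variable {ι : Type*} [Fintype ι] [DecidableEq ι] {c T : ℝ} {a : EuclideanSpace ℝ ι → ι → ℂ}
  {b : ℝ → EuclideanSpace ℝ ι → ι → ℂ}

/-- `picardIterForced c T a b n t = picardIterForced c T a b n (clamp T t)` (`T ≥ 0`).
[cite: Tao2011, Thm. 5.4 (ii) (arXiv Thm. 31), Duhamel formula (7)] -/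
theorem picardIterForced_clamp (hT : 0 ≤ T) (n : ℕ) (t : ℝ) :
    picardIterForced c T a b n (clamp T t) = picardIterForced c T a b n t := by
  cases n with
  | zero => funext ξ; simp [picardIterForced, clamp_clamp hT, forcing_clamp hT]
  | succ n => funext ξ; exact duhamelForced_clamp hT t ξ

end Clamp

/-! ### Geometric decay of the weighted `L²` majorants of the differences -/

section Differences

variable {c T : ℝ} {a : EuclideanSpace ℝ (Fin 3) → Fin 3 → ℂ}
  {b : ℝ → EuclideanSpace ℝ (Fin 3) → Fin 3 → ℂ}

/-- **Geometric decay of the differences of the forced Picard iterates, weighted `L²`-majorant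
form.**
Under the hypotheses of `picard_uniform_bounds_forced'` (finite `δ₁, δ₂`) and for every `K`, there
are `λ > 0` and a finite `b` such that for every `n` the difference
`d_n = picardIterForced n - picardIterForced (n+1)` admits a
measurable `Q_n` with `∫⁻ Q_n² ≤ (b 2^{-n})²` and
`e^{-λt}(1+‖ξ‖)^{K+2} ‖d_n(t, ξ)‖ₑ ≤ Q_n(ξ)` on `[0, T]`, together with the pointwise bound
`e^{-λt}(1+‖ξ‖)^{K+2} ‖d_n(t, ξ)‖ₑ ≤ B_p 2^{-n}` (Cauchy–Schwarz, `diff_majorant_le`)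
(`Q_0 = R_1 + R_0` of `exists_uniform_weighted_majorant_picardIterForced'`, since
`d_0 = E_1 − E_0`; `Q_{n+1} = μ·3((Q₀ ⋆ₗ G_K) + (Q ⋆ₗ G₀) + (G₀' ⋆ₗ Q) + (G_K ⋆ₗ Q₀))` of
`exp_weight_enorm_duhamelIntegral_hsub_sub_le` — the forcing term CANCELS in
`d_{n+1} = duhamelIntegral c T w_{n+1} − duhamelIntegral c T w_n` — whose `L²` norm contracts by
`1/2` for `λ` large, `lintegral_diff_majorant_sq_le`). This is the contraction half of the proof of
Thm. 5.1 (arXiv Thm. 28, p. 16) for the Duhamel map WITH force.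
[cite: Tao2011, Thm. 5.4 (ii) (arXiv Thm. 31); proof of Thm. 5.1 (arXiv Thm. 28, p. 16)] -/
theorem exists_geometric_weighted_majorant_diff_picardIterForced (hc : 0 < c) (hT : 0 ≤ T)
    (ha : AEStronglyMeasurable a volume)
    (haw : ∀ (k : ℕ) j, ∫⁻ η, (ENNReal.ofReal ((1 + ‖η‖) ^ k) * ‖a η j‖ₑ) ^ 2 < ⊤)
    (hbm : Measurable (uncurry b)) (hbt : ∀ ξ, Continuous fun s => b s ξ)
    (hbd : ∀ K : ℕ, ∃ B : ℝ, ∀ s, HasDecay K B (b s))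
    {δ₁ δ₂ : ℝ≥0∞} (hδ₁ : δ₁ < ⊤) (hδ₂ : δ₂ < ⊤)
    (hα₁ : ∫⁻ η, (ENNReal.ofReal ‖η‖ * ∑ j, ‖a η j‖ₑ) ^ 2 ≤ δ₁)
    (hα₂ : ∫⁻ η, (ENNReal.ofReal (‖η‖ ^ 2) * ∑ j, ‖a η j‖ₑ) ^ 2 ≤ δ₂)
    (hF₁ : ∀ t ∈ Icc 0 T, ∫⁻ η, (ENNReal.ofReal ‖η‖ * ∑ j, ‖forcing c T b t η j‖ₑ) ^ 2 ≤ δ₁)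
    (hG₁ : ∫⁻ t in Ioc 0 T, ∫⁻ η, (ENNReal.ofReal (‖η‖ ^ 2) *
      ∑ j, ‖forcing c T b t η j‖ₑ) ^ 2 ≤ ENNReal.ofReal c⁻¹ * δ₁)
    (hF₂ : ∀ t ∈ Icc 0 T, ∫⁻ η, (ENNReal.ofReal (‖η‖ ^ 2) * ∑ j, ‖forcing c T b t η j‖ₑ) ^ 2 ≤ δ₂)
    (hG₂ : ∫⁻ t in Ioc 0 T, ∫⁻ η, (ENNReal.ofReal (‖η‖ ^ 3) *
      ∑ j, ‖forcing c T b t η j‖ₑ) ^ 2 ≤ ENNReal.ofReal c⁻¹ * δ₂)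
    (hs : 36864 * (ENNReal.ofReal (4 * π) * (Fintype.card (Fin 3) : ℝ≥0∞) ^ 2) ^ 2 *
        ((SNormLESNormFDerivOfEqConst ℂ (volume : Measure (EuclideanSpace ℝ (Fin 3))) 2 *
          ENNReal.ofReal (2 * π)) ^ (3 / 2 : ℝ)) ^ 2 * ENNReal.ofReal c⁻¹ *
        (ENNReal.ofReal T * ENNReal.ofReal c⁻¹) ^ (1 / 2 : ℝ) * δ₁ ≤ 1) (K : ℕ) :
    ∃ lam : ℝ, 0 < lam ∧ ∃ bq : ℝ≥0∞, bq < ⊤ ∧ ∃ Bp : ℝ≥0∞, Bp < ⊤ ∧ ∀ n : ℕ,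
      ∃ Q : EuclideanSpace ℝ (Fin 3) → ℝ≥0∞, AEMeasurable Q volume ∧
        ∫⁻ ξ, Q ξ ^ 2 ≤ (bq * 2⁻¹ ^ n) ^ 2 ∧
        (∀ t ∈ Icc 0 T, ∀ ξ, ENNReal.ofReal (Real.exp (-lam * t) * (1 + ‖ξ‖) ^ (K + 2)) *
          ‖picardIterForced c T a b n t ξ - picardIterForced c T a b (n + 1) t ξ‖ₑ ≤ Q ξ) ∧
        (∀ t ∈ Icc 0 T, ∀ ξ, ENNReal.ofReal (Real.exp (-lam * t) * (1 + ‖ξ‖) ^ (K + 2)) *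
          ‖picardIterForced c T a b n t ξ - picardIterForced c T a b (n + 1) t ξ‖ₑ ≤ Bp * 2⁻¹ ^ n) := by
  obtain ⟨Λ, hΛ, hΨ⟩ := exists_uniform_envelope_picardIterForced' hc hT ha haw hbm hbt hbd hδ₁ hδ₂ hα₁ hα₂ hF₁ hG₁ hF₂ hG₂ hs
  obtain ⟨Bd, hBd⟩ := exists_uniform_hasDecay_picardIterForced' hc hT ha haw hbm hbt hbd hδ₁ hδ₂ hα₁ hα₂ hF₁ hG₁ hF₂ hG₂ hs (K + 2 + 2)
  obtain ⟨lamR, hlamR, β, hβ, hR⟩ := exists_uniform_weighted_majorant_picardIterForced' hc hT ha haw hbm hbt hbd hδ₁ hδ₂ hα₁ hα₂ hF₁ hG₁ hF₂ hG₂ hs (K + 2)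
  set C : ℝ≥0∞ := ENNReal.ofReal (4 * π) * (Fintype.card (Fin 3) : ℝ≥0∞) ^ 2 with hC
  have hCtop : C < ⊤ := ENNReal.mul_lt_top ENNReal.ofReal_lt_top (by simp)
  set Amaj : EuclideanSpace ℝ (Fin 3) → ℝ≥0∞ := fun η => ∑ j, ‖a η j‖ₑ with hAmaj
  have hAm : AEMeasurable Amaj volume := aemeasurable_majorant ha
  -- data constants
  set W2 : ℝ≥0∞ := ∫⁻ ξ : EuclideanSpace ℝ (Fin 3), (ENNReal.ofReal ((1 + ‖ξ‖) ^ 2))⁻¹ ^ 2 with hW2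
  have hW2top : W2 < ⊤ := lintegral_weight_inv_sq_lt_top finrank_three_lt_four
  set WK : ℝ≥0∞ := ∫⁻ ξ : EuclideanSpace ℝ (Fin 3), (ENNReal.ofReal ((1 + ‖ξ‖) ^ (K + 2)))⁻¹ ^ 2 with hWK
  have hWKtop : WK < ⊤ := by
    refine lt_of_le_of_lt (lintegral_mono fun ξ => pow_le_pow_left' ?_ 2) hW2top
    exact ENNReal.inv_le_inv.2 (ENNReal.ofReal_le_ofReal
      (pow_le_pow_right₀ (by linarith [norm_nonneg ξ]) (by omega)))
  set αw2 : ℝ≥0∞ := ∫⁻ η, (ENNReal.ofReal ((1 + ‖η‖) ^ 2) * Amaj η) ^ 2 with hαw2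
  set αwK : ℝ≥0∞ := ∫⁻ η, (ENNReal.ofReal ((1 + ‖η‖) ^ (K + 2)) * Amaj η) ^ 2 with hαwK
  have hαwKtop : αwK < ⊤ := lintegral_weight_majorant_sq_lt_top ha (K + 2) (haw (K + 2))
  have hrt : ∀ {x : ℝ≥0∞}, x < ⊤ → x ^ (1 / 2 : ℝ) < ⊤ := fun h =>
    ENNReal.rpow_lt_top_of_nonneg (by norm_num) h.ne
  -- the uniform decay bound in `ℝ≥0∞` form
  set b₀ : ℝ≥0∞ := ENNReal.ofReal Bd with hb₀
  have hdec : ∀ n s η, ENNReal.ofReal ((1 + ‖η‖) ^ (K + 2 + 2)) *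
      ‖heat c η (clamp T s) • a η - picardIterForced c T a b n s η‖ₑ ≤ b₀ := by
    intro n s η
    have h := (hBd n s).enorm_le η
    have hw0 : ENNReal.ofReal ((1 + ‖η‖) ^ (K + 2 + 2)) ≠ 0 :=
      (lt_of_lt_of_le zero_lt_one (one_le_ofReal_weight _ η)).ne'
    calc ENNReal.ofReal ((1 + ‖η‖) ^ (K + 2 + 2)) * ‖heat c η (clamp T s) • a η - picardIterForced c T a b n s η‖ₑ
        ≤ ENNReal.ofReal ((1 + ‖η‖) ^ (K + 2 + 2)) * (b₀ * (ENNReal.ofReal ((1 + ‖η‖) ^ (K + 2 + 2)))⁻¹) :=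
          mul_le_mul' le_rfl h
      _ = b₀ := by
          rw [mul_comm b₀, ← mul_assoc, ENNReal.mul_inv_cancel hw0 ENNReal.ofReal_ne_top, one_mul]
  -- the uniform `L¹` bound of `G₀ = Amaj + 3Ψ` and the `L²` bound of `G_K`
  set γ : ℝ≥0∞ := (W2 * αw2) ^ (1 / 2 : ℝ) + 3 * (W2 * Λ) ^ (1 / 2 : ℝ) with hγ
  have hγtop : γ < ⊤ :=
    ENNReal.add_lt_top.2 ⟨hrt (ENNReal.mul_lt_top hW2top (lintegral_weight_majorant_sq_lt_top ha 2 (haw 2))),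
      ENNReal.mul_lt_top (by norm_num) (hrt (ENNReal.mul_lt_top hW2top hΛ))⟩
  have hG₀L1 : ∀ {Ψ : EuclideanSpace ℝ (Fin 3) → ℝ≥0∞}, Measurable Ψ →
      ∫⁻ η, (ENNReal.ofReal ((1 + ‖η‖) ^ 2) * Ψ η) ^ 2 ≤ Λ → ∫⁻ η, (Amaj η + 3 * Ψ η) ≤ γ := by
    intro Ψ hΨm hΨΛ
    rw [lintegral_add_left' hAm, lintegral_const_mul' _ _ (by norm_num)]
    exact add_le_add (lintegral_le_rpow_half_of_weight_sq_le hAm 2 le_rfl)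
      (mul_le_mul' le_rfl (lintegral_le_rpow_half_of_weight_sq_le hΨm.aemeasurable 2 hΨΛ))
  set αw0 : ℝ≥0∞ := ∫⁻ η, Amaj η ^ 2 with hαw0
  have hαw0top : αw0 < ⊤ := by
    have h := lintegral_weight_majorant_sq_lt_top ha 0 (haw 0)
    simpa using h
  set g0b : ℝ≥0∞ := 2 * αw0 + 18 * Λ with hg0b
  have hg0btop : g0b < ⊤ := ENNReal.add_lt_top.2 ⟨ENNReal.mul_lt_top (by norm_num) hαw0top,
    ENNReal.mul_lt_top (by norm_num) hΛ⟩
  have hsq : ∀ x y : ℝ≥0∞, (x + y) ^ 2 ≤ 2 * x ^ 2 + 2 * y ^ 2 := fun x y => by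
    have h := ENNReal.rpow_add_le_mul_rpow_add_rpow x y (p := 2) (by norm_num)
    norm_num at h
    rw [← mul_add]
    exact_mod_cast h
  have hG₀2 : ∀ {Ψ : EuclideanSpace ℝ (Fin 3) → ℝ≥0∞}, Measurable Ψ →
      ∫⁻ η, (ENNReal.ofReal ((1 + ‖η‖) ^ 2) * Ψ η) ^ 2 ≤ Λ → ∫⁻ η, (Amaj η + 3 * Ψ η) ^ 2 ≤ g0b := by
    intro Ψ hΨm hΨΛ
    calc ∫⁻ η, (Amaj η + 3 * Ψ η) ^ 2 ≤ ∫⁻ η, (2 * Amaj η ^ 2 + 2 * (3 * Ψ η) ^ 2) :=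
          lintegral_mono fun η => hsq _ _
      _ = 2 * αw0 + 18 * ∫⁻ η, Ψ η ^ 2 := by
          rw [lintegral_add_left' (f := fun η => 2 * Amaj η ^ 2) ((hAm.pow_const 2).const_mul _),
            lintegral_const_mul' _ _ (by norm_num), ← hαw0]
          have h9 : ∀ η, 2 * (3 * Ψ η) ^ 2 = 18 * Ψ η ^ 2 := fun η => by ring
          simp_rw [h9]
          rw [lintegral_const_mul' _ _ (by norm_num)]
      _ ≤ 2 * αw0 + 18 * Λ := by
          refine add_le_add le_rfl (mul_le_mul' le_rfl ((lintegral_mono fun η => ?_).trans hΨΛ))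
          rw [mul_pow]
          calc Ψ η ^ 2 = 1 * Ψ η ^ 2 := (one_mul _).symm
            _ ≤ ENNReal.ofReal ((1 + ‖η‖) ^ 2) ^ 2 * Ψ η ^ 2 :=
                mul_le_mul' (one_le_pow₀ (one_le_ofReal_weight 2 η)) le_rfl
  set GK : EuclideanSpace ℝ (Fin 3) → ℝ≥0∞ := fun η => ENNReal.ofReal ((1 + ‖η‖) ^ (K + 2)) * Amaj η +
    3 * (b₀ * (ENNReal.ofReal ((1 + ‖η‖) ^ 2))⁻¹) with hGK
  have hGKm : AEMeasurable GK volume :=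
    ((measurable_ofReal_weight (K + 2)).aemeasurable.mul hAm).add
      (((measurable_ofReal_weight 2).inv.const_mul _).const_mul _).aemeasurable
  set gk : ℝ≥0∞ := 2 * αwK + 18 * (b₀ ^ 2 * W2) with hgk
  have hgktop : gk < ⊤ := ENNReal.add_lt_top.2 ⟨ENNReal.mul_lt_top (by norm_num) hαwKtop,
    ENNReal.mul_lt_top (by norm_num) (ENNReal.mul_lt_top (ENNReal.pow_lt_top ENNReal.ofReal_lt_top) hW2top)⟩
  have hGK2 : ∫⁻ η, GK η ^ 2 ≤ gk := by
    calc ∫⁻ η, GK η ^ 2 ≤ ∫⁻ η, (2 * (ENNReal.ofReal ((1 + ‖η‖) ^ (K + 2)) * Amaj η) ^ 2 +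
          2 * (3 * (b₀ * (ENNReal.ofReal ((1 + ‖η‖) ^ 2))⁻¹)) ^ 2) := lintegral_mono fun η => hsq _ _
      _ = 2 * αwK + 18 * (b₀ ^ 2 * W2) := by
          rw [lintegral_add_left' (f := fun η => 2 * (ENNReal.ofReal ((1 + ‖η‖) ^ (K + 2)) * Amaj η) ^ 2)
            ((((measurable_ofReal_weight (K + 2)).aemeasurable.mul hAm).pow_const 2).const_mul _),
            lintegral_const_mul' _ _ (by norm_num), ← hαwK]
          have h9 : ∀ η : EuclideanSpace ℝ (Fin 3), 2 * (3 * (b₀ * (ENNReal.ofReal ((1 + ‖η‖) ^ 2))⁻¹)) ^ 2 =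
              18 * b₀ ^ 2 * (ENNReal.ofReal ((1 + ‖η‖) ^ 2))⁻¹ ^ 2 := fun η => by ring
          simp_rw [h9]
          rw [lintegral_const_mul' _ _ (ENNReal.mul_ne_top (by norm_num)
            (ENNReal.pow_ne_top ENNReal.ofReal_ne_top)), ← hW2]
          ring
  -- the choice of `λ`
  set Z₀ : ℝ≥0∞ := 36 * (2 * (WK * gk) + (γ ^ 2 + γ ^ 2)) with hZ₀
  have hZ₀top : Z₀ < ⊤ := ENNReal.mul_lt_top (by norm_num) (ENNReal.add_lt_top.2
    ⟨ENNReal.mul_lt_top (by norm_num) (ENNReal.mul_lt_top hWKtop hgktop),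
     ENNReal.add_lt_top.2 ⟨ENNReal.pow_lt_top hγtop, ENNReal.pow_lt_top hγtop⟩⟩)
  set X : ℝ≥0∞ := (C * 2 ^ (K + 2)) ^ 2 * Z₀ with hX
  have hXtop : X < ⊤ := ENNReal.mul_lt_top (ENNReal.pow_lt_top (ENNReal.mul_lt_top hCtop
    (ENNReal.pow_lt_top (by simp)))) hZ₀top
  set lam : ℝ := lamR + X.toReal / c + 1 with hlam
  have hlam0 : 0 < lam := by positivity
  have hlamR' : lamR ≤ lam := by
    rw [hlam]; have : 0 ≤ X.toReal / c := by positivity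
    linarith
  set μ : ℝ≥0∞ := ENNReal.ofReal (1 / (2 * Real.sqrt (c * lam))) * (C * 2 ^ (K + 2)) with hμ
  have hkey : (μ ^ 2 * Z₀) * 4 ≤ 1 := by
    have hsq' : ENNReal.ofReal (1 / (2 * Real.sqrt (c * lam))) ^ 2 = ENNReal.ofReal (1 / (4 * (c * lam))) := by
      rw [← ENNReal.ofReal_pow (by positivity), div_pow, mul_pow, Real.sq_sqrt (by positivity)]
      norm_num
    have h1 : μ ^ 2 * Z₀ = ENNReal.ofReal (1 / (4 * (c * lam))) * X := by
      rw [hμ, mul_pow, hsq', hX]; ring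
    have h2 : ENNReal.ofReal (1 / (4 * (c * lam))) * 4 = ENNReal.ofReal (1 / (c * lam)) := by
      rw [show (4 : ℝ≥0∞) = ENNReal.ofReal 4 by norm_num, ← ENNReal.ofReal_mul (by positivity)]
      congr 1
      field_simp
    have hcl : X.toReal ≤ c * lam := by
      rw [hlam]
      have h' : c * (lamR + X.toReal / c + 1) = c * lamR + X.toReal + c := by field_simp
      rw [h']
      nlinarith [hlamR.le, hc.le]
    calc μ ^ 2 * Z₀ * 4 = ENNReal.ofReal (1 / (c * lam)) * X := by
          rw [h1, mul_assoc, mul_comm X 4, ← mul_assoc, h2]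
      _ = ENNReal.ofReal (1 / (c * lam) * X.toReal) := by
          rw [ENNReal.ofReal_mul (by positivity), ENNReal.ofReal_toReal hXtop.ne]
      _ ≤ ENNReal.ofReal 1 := by
          refine ENNReal.ofReal_le_ofReal ?_
          rw [one_div_mul_eq_div, div_le_one (by positivity)]
          exact hcl
      _ = 1 := ENNReal.ofReal_one
  have hkey' : μ ^ 2 * Z₀ ≤ 4⁻¹ := ENNReal.le_inv_iff_mul_le.2 hkey
  -- the base majorant and the exponential monotonicity in `λ`
  have hexp : ∀ {t : ℝ}, 0 ≤ t → ∀ (x : ℝ), 0 ≤ x →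
      ENNReal.ofReal (Real.exp (-lam * t) * x) ≤ ENNReal.ofReal (Real.exp (-lamR * t) * x) := by
    intro t ht x hx
    refine ENNReal.ofReal_le_ofReal (mul_le_mul_of_nonneg_right (Real.exp_le_exp.2 ?_) hx)
    nlinarith
  set bb : ℝ≥0∞ := (4 * β) ^ (1 / 2 : ℝ) with hbb
  have hbbtop : bb < ⊤ := hrt (ENNReal.mul_lt_top (by norm_num) hβ)
  have hbb2 : bb ^ 2 = 4 * β := by
    rw [hbb, ← ENNReal.rpow_natCast, ← ENNReal.rpow_mul]; norm_num
  -- the pointwise constant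
  set Mpt : ℝ≥0∞ := μ * (3 * ((2 * gk ^ (1 / 2 : ℝ) + (g0b ^ (1 / 2 : ℝ) + g0b ^ (1 / 2 : ℝ))) * bb)) * 2
    with hMpt
  have hμtop : μ < ⊤ := ENNReal.mul_lt_top ENNReal.ofReal_lt_top
    (ENNReal.mul_lt_top hCtop (ENNReal.pow_lt_top (by simp)))
  have hMpttop : Mpt < ⊤ := by
    refine ENNReal.mul_lt_top (ENNReal.mul_lt_top hμtop (ENNReal.mul_lt_top (by norm_num)
      (ENNReal.mul_lt_top ?_ hbbtop))) (by norm_num)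
    exact ENNReal.add_lt_top.2 ⟨ENNReal.mul_lt_top (by norm_num) (hrt hgktop),
      ENNReal.add_lt_top.2 ⟨hrt hg0btop, hrt hg0btop⟩⟩
  have hb₀top : b₀ < ⊤ := ENNReal.ofReal_lt_top
  refine ⟨lam, hlam0, bb, hbbtop, b₀ + b₀ + Mpt,
    ENNReal.add_lt_top.2 ⟨ENNReal.add_lt_top.2 ⟨hb₀top, hb₀top⟩, hMpttop⟩, fun n => ?_⟩
  induction n with
  | zero =>
    obtain ⟨R₀, hR₀m, hR₀β, hR₀b⟩ := hR 0
    obtain ⟨R₁, hR₁m, hR₁β, hR₁b⟩ := hR 1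
    have h0 : ∀ t ξ, picardIterForced c T a b 0 t ξ - picardIterForced c T a b 1 t ξ =
        (heat c ξ (clamp T t) • a ξ - picardIterForced c T a b 1 t ξ) -
          (heat c ξ (clamp T t) • a ξ - picardIterForced c T a b 0 t ξ) := fun t ξ => by abel
    have hE1 : ∀ {t : ℝ}, t ∈ Icc 0 T → ENNReal.ofReal (Real.exp (-lam * t)) ≤ 1 := fun {t} ht => by
      rw [← ENNReal.ofReal_one]
      exact ENNReal.ofReal_le_ofReal (Real.exp_le_one_iff.2 (by nlinarith [ht.1]))
    have hw : ∀ ξ : EuclideanSpace ℝ (Fin 3),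
        ENNReal.ofReal ((1 + ‖ξ‖) ^ (K + 2)) ≤ ENNReal.ofReal ((1 + ‖ξ‖) ^ (K + 2 + 2)) := fun ξ =>
      ENNReal.ofReal_le_ofReal (pow_le_pow_right₀ (by linarith [norm_nonneg ξ]) (by omega))
    have hpt0 : ∀ (m : ℕ), ∀ t ∈ Icc 0 T, ∀ ξ, ENNReal.ofReal (Real.exp (-lam * t) * (1 + ‖ξ‖) ^ (K + 2)) *
        ‖heat c ξ (clamp T t) • a ξ - picardIterForced c T a b m t ξ‖ₑ ≤ b₀ := by
      intro m t ht ξ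
      calc ENNReal.ofReal (Real.exp (-lam * t) * (1 + ‖ξ‖) ^ (K + 2)) *
            ‖heat c ξ (clamp T t) • a ξ - picardIterForced c T a b m t ξ‖ₑ
          ≤ 1 * ENNReal.ofReal ((1 + ‖ξ‖) ^ (K + 2 + 2)) *
            ‖heat c ξ (clamp T t) • a ξ - picardIterForced c T a b m t ξ‖ₑ := by
            rw [ENNReal.ofReal_mul (Real.exp_pos _).le]
            exact mul_le_mul' (mul_le_mul' (hE1 ht) (hw ξ)) le_rfl
        _ ≤ b₀ := by rw [one_mul]; exact hdec m t ξ
    refine ⟨fun ξ => R₁ ξ + R₀ ξ, hR₁m.add hR₀m, ?_, fun t ht ξ => ?_, fun t ht ξ => ?_⟩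
    · calc ∫⁻ ξ, (R₁ ξ + R₀ ξ) ^ 2 ≤ ∫⁻ ξ, (2 * R₁ ξ ^ 2 + 2 * R₀ ξ ^ 2) :=
            lintegral_mono fun ξ => hsq _ _
        _ = 2 * (∫⁻ ξ, R₁ ξ ^ 2) + 2 * ∫⁻ ξ, R₀ ξ ^ 2 := by
            rw [lintegral_add_left' ((hR₁m.pow_const 2).const_mul _), lintegral_const_mul' _ _ (by norm_num),
              lintegral_const_mul' _ _ (by norm_num)]
        _ ≤ 2 * β + 2 * β := add_le_add (mul_le_mul' le_rfl hR₁β) (mul_le_mul' le_rfl hR₀β)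
        _ = (bb * 2⁻¹ ^ 0) ^ 2 := by rw [pow_zero, mul_one, hbb2]; ring
    · rw [h0]
      calc ENNReal.ofReal (Real.exp (-lam * t) * (1 + ‖ξ‖) ^ (K + 2)) *
            ‖(heat c ξ (clamp T t) • a ξ - picardIterForced c T a b 1 t ξ) -
              (heat c ξ (clamp T t) • a ξ - picardIterForced c T a b 0 t ξ)‖ₑ
          ≤ ENNReal.ofReal (Real.exp (-lam * t) * (1 + ‖ξ‖) ^ (K + 2)) *
            (‖heat c ξ (clamp T t) • a ξ - picardIterForced c T a b 1 t ξ‖ₑ +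
              ‖heat c ξ (clamp T t) • a ξ - picardIterForced c T a b 0 t ξ‖ₑ) :=
            mul_le_mul' le_rfl enorm_sub_le
        _ = ENNReal.ofReal (Real.exp (-lam * t) * (1 + ‖ξ‖) ^ (K + 2)) *
              ‖heat c ξ (clamp T t) • a ξ - picardIterForced c T a b 1 t ξ‖ₑ +
            ENNReal.ofReal (Real.exp (-lam * t) * (1 + ‖ξ‖) ^ (K + 2)) *
              ‖heat c ξ (clamp T t) • a ξ - picardIterForced c T a b 0 t ξ‖ₑ := mul_add _ _ _
        _ ≤ R₁ ξ + R₀ ξ := add_le_add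
            ((mul_le_mul' (hexp ht.1 _ (by positivity)) le_rfl).trans (hR₁b t ht ξ))
            ((mul_le_mul' (hexp ht.1 _ (by positivity)) le_rfl).trans (hR₀b t ht ξ))
    · rw [h0, pow_zero, mul_one]
      calc ENNReal.ofReal (Real.exp (-lam * t) * (1 + ‖ξ‖) ^ (K + 2)) *
            ‖(heat c ξ (clamp T t) • a ξ - picardIterForced c T a b 1 t ξ) -
              (heat c ξ (clamp T t) • a ξ - picardIterForced c T a b 0 t ξ)‖ₑ
          ≤ ENNReal.ofReal (Real.exp (-lam * t) * (1 + ‖ξ‖) ^ (K + 2)) *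
            (‖heat c ξ (clamp T t) • a ξ - picardIterForced c T a b 1 t ξ‖ₑ +
              ‖heat c ξ (clamp T t) • a ξ - picardIterForced c T a b 0 t ξ‖ₑ) :=
            mul_le_mul' le_rfl enorm_sub_le
        _ = ENNReal.ofReal (Real.exp (-lam * t) * (1 + ‖ξ‖) ^ (K + 2)) *
              ‖heat c ξ (clamp T t) • a ξ - picardIterForced c T a b 1 t ξ‖ₑ +
            ENNReal.ofReal (Real.exp (-lam * t) * (1 + ‖ξ‖) ^ (K + 2)) *
              ‖heat c ξ (clamp T t) • a ξ - picardIterForced c T a b 0 t ξ‖ₑ := mul_add _ _ _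
        _ ≤ b₀ + b₀ := add_le_add (hpt0 1 t ht ξ) (hpt0 0 t ht ξ)
        _ ≤ b₀ + b₀ + Mpt := le_self_add
  | succ n ih =>
    obtain ⟨Q, hQm, hQ2, hQb, -⟩ := ih
    obtain ⟨Ψ, hΨm, hΨb, hΨΛ⟩ := hΨ (n + 1)
    obtain ⟨Ψ', hΨ'm, hΨ'b, hΨ'Λ⟩ := hΨ n
    -- the two Duhamel parts
    set En : ℝ → EuclideanSpace ℝ (Fin 3) → Fin 3 → ℂ :=
      fun t ξ => heat c ξ (clamp T t) • a ξ - picardIterForced c T a b n t ξ with hEn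
    set En' : ℝ → EuclideanSpace ℝ (Fin 3) → Fin 3 → ℂ :=
      fun t ξ => heat c ξ (clamp T t) • a ξ - picardIterForced c T a b (n + 1) t ξ with hEn'
    have hvn : (fun s η => heat c η (clamp T s) • a η - En s η) = picardIterForced c T a b n := by
      funext s η; simp [hEn]
    have hvn' : (fun s η => heat c η (clamp T s) • a η - En' s η) = picardIterForced c T a b (n + 1) := by
      funext s η; simp [hEn']
    have hstep : ∀ t ξ, picardIterForced c T a b (n + 1) t ξ = heat c ξ (clamp T t) • a ξ -
        duhamelIntegral c T (fun s η => heat c η (clamp T s) • a η - En s η) t ξ +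
        forcing c T b t ξ := by
      intro t ξ; rw [hvn, picardIterForced_succ, duhamelForced_eq_sub]; abel
    have hstep' : ∀ t ξ, picardIterForced c T a b (n + 1 + 1) t ξ = heat c ξ (clamp T t) • a ξ -
        duhamelIntegral c T (fun s η => heat c η (clamp T s) • a η - En' s η) t ξ +
        forcing c T b t ξ := by
      intro t ξ; rw [hvn', picardIterForced_succ, duhamelForced_eq_sub]; abel
    obtain ⟨-, hEm, hEt, hEd⟩ := class_picardIterForced' hc.le hT ha haw hbm hbt hbd n
    obtain ⟨-, hE'm, hE't, hE'd⟩ := class_picardIterForced' hc.le hT ha haw hbm hbt hbd (n + 1)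
    -- the new majorant
    set G₀ : EuclideanSpace ℝ (Fin 3) → ℝ≥0∞ := fun η => Amaj η + 3 * Ψ η with hG₀
    set G₀' : EuclideanSpace ℝ (Fin 3) → ℝ≥0∞ := fun η => Amaj η + 3 * Ψ' η with hG₀'
    have hG₀m : AEMeasurable G₀ volume := hAm.add (hΨm.aemeasurable.const_mul _)
    have hG₀'m : AEMeasurable G₀' volume := hAm.add (hΨ'm.aemeasurable.const_mul _)
    set Q₀ : EuclideanSpace ℝ (Fin 3) → ℝ≥0∞ := fun η => (ENNReal.ofReal ((1 + ‖η‖) ^ (K + 2)))⁻¹ * Q η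
      with hQ₀
    have hQ₀m : AEMeasurable Q₀ volume := (measurable_ofReal_weight (K + 2)).aemeasurable.inv.mul hQm
    -- the step bound, shared by the last two conjuncts
    have hmain : ∀ t ∈ Icc 0 T, ∀ ξ, ENNReal.ofReal (Real.exp (-lam * t) * (1 + ‖ξ‖) ^ (K + 2)) *
        ‖picardIterForced c T a b (n + 1) t ξ - picardIterForced c T a b (n + 1 + 1) t ξ‖ₑ ≤
        μ * (3 * ((Q₀ ⋆ₗ GK) ξ + (Q ⋆ₗ G₀) ξ + (G₀' ⋆ₗ Q) ξ + (GK ⋆ₗ Q₀) ξ)) := by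
      intro t ht ξ
      -- the difference of two consecutive iterates is a difference of Duhamel integrals
      have hdiff : picardIterForced c T a b (n + 1) t ξ - picardIterForced c T a b (n + 1 + 1) t ξ =
          duhamelIntegral c T (fun s η => heat c η (clamp T s) • a η - En' s η) t ξ -
            duhamelIntegral c T (fun s η => heat c η (clamp T s) • a η - En s η) t ξ := by
        rw [hstep, hstep']; abel
      have hΨ₁ : ∀ s ∈ Icc 0 T, ∀ η, ‖En' s η‖ₑ ≤ Ψ η := fun s _ η => hΨb s η
      have hΨ₂ : ∀ s ∈ Icc 0 T, ∀ η, ‖En s η‖ₑ ≤ Ψ' η := fun s _ η => hΨ'b s η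
      have hB₁ : ∀ s ∈ Icc 0 T, ∀ η, ENNReal.ofReal ((1 + ‖η‖) ^ (K + 2 + 2)) * ‖En' s η‖ₑ ≤ b₀ :=
        fun s _ η => hdec (n + 1) s η
      have hB₂ : ∀ s ∈ Icc 0 T, ∀ η, ENNReal.ofReal ((1 + ‖η‖) ^ (K + 2 + 2)) * ‖En s η‖ₑ ≤ b₀ :=
        fun s _ η => hdec n s η
      have hQ' : ∀ s ∈ Icc 0 T, ∀ η, ENNReal.ofReal (Real.exp (-lam * s) * (1 + ‖η‖) ^ (K + 2)) *
          ‖En' s η - En s η‖ₑ ≤ Q η := by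
        intro s hs η
        have hEE : En' s η - En s η = picardIterForced c T a b n s η - picardIterForced c T a b (n + 1) s η := by
          simp only [hEn, hEn', sub_sub_sub_cancel_left]
        rw [hEE]
        exact hQb s hs η
      have h := exp_weight_enorm_duhamelIntegral_hsub_sub_le' (T := T) hc ha haw hE'm hE't hE'd hEm hEt hEd (K + 2)
        hlam0 hΨ₁ hΨ₂ hB₁ hB₂ hQ' ht ξ
      rw [hdiff]
      refine h.trans (le_of_eq ?_)
      simp only [hμ, hC, hQ₀, hGK, hG₀, hG₀', hAmaj]
      ring
    refine ⟨fun ξ => μ * (3 * ((Q₀ ⋆ₗ GK) ξ + (Q ⋆ₗ G₀) ξ + (G₀' ⋆ₗ Q) ξ + (GK ⋆ₗ Q₀) ξ)), ?_, ?_,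
      hmain, fun t ht ξ => (hmain t ht ξ).trans ?_⟩
    · exact ((((aemeasurable_lconvolution hQ₀m hGKm).add (aemeasurable_lconvolution hQm hG₀m)).add
        (aemeasurable_lconvolution hG₀'m hQm)).add (aemeasurable_lconvolution hGKm hQ₀m)).const_mul _
        |>.const_mul _
    · calc _ ≤ μ ^ 2 * (36 * ((2 * (WK * ∫⁻ η, GK η ^ 2) + ((∫⁻ η, G₀ η) ^ 2 + (∫⁻ η, G₀' η) ^ 2)) *
            ∫⁻ η, Q η ^ 2)) := lintegral_diff_majorant_sq_le hQm hG₀m hG₀'m hGKm (K + 2) μ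
        _ ≤ μ ^ 2 * (36 * ((2 * (WK * gk) + (γ ^ 2 + γ ^ 2)) * (bb * 2⁻¹ ^ n) ^ 2)) := by
            gcongr
            · exact hG₀L1 hΨm hΨΛ
            · exact hG₀L1 hΨ'm hΨ'Λ
        _ = (μ ^ 2 * Z₀) * (bb * 2⁻¹ ^ n) ^ 2 := by rw [hZ₀]; ring
        _ ≤ 4⁻¹ * (bb * 2⁻¹ ^ n) ^ 2 := mul_le_mul' hkey' le_rfl
        _ = (bb * 2⁻¹ ^ (n + 1)) ^ 2 := by
            rw [pow_succ, show (4 : ℝ≥0∞)⁻¹ = 2⁻¹ ^ 2 by rw [← ENNReal.inv_pow]; norm_num]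
            ring
    · -- the pointwise bound through Cauchy–Schwarz
      have hq : (∫⁻ η, Q η ^ 2) ^ (1 / 2 : ℝ) ≤ bb * 2⁻¹ ^ n := by
        have h := ENNReal.rpow_le_rpow (z := (1 / 2 : ℝ)) hQ2 (by norm_num)
        rwa [← ENNReal.rpow_natCast (bb * 2⁻¹ ^ n) 2, ← ENNReal.rpow_mul,
          show ((2 : ℕ) : ℝ) * (1 / 2) = 1 by norm_num, ENNReal.rpow_one] at h
      calc μ * (3 * ((Q₀ ⋆ₗ GK) ξ + (Q ⋆ₗ G₀) ξ + (G₀' ⋆ₗ Q) ξ + (GK ⋆ₗ Q₀) ξ))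
          ≤ μ * (3 * ((2 * (∫⁻ η, GK η ^ 2) ^ (1 / 2 : ℝ) + (∫⁻ η, G₀ η ^ 2) ^ (1 / 2 : ℝ) +
              (∫⁻ η, G₀' η ^ 2) ^ (1 / 2 : ℝ)) * (∫⁻ η, Q η ^ 2) ^ (1 / 2 : ℝ))) :=
            diff_majorant_le hQm hG₀m hG₀'m hGKm (K + 2) μ ξ
        _ ≤ μ * (3 * ((2 * gk ^ (1 / 2 : ℝ) + (g0b ^ (1 / 2 : ℝ) + g0b ^ (1 / 2 : ℝ))) * (bb * 2⁻¹ ^ n))) := by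
            refine mul_le_mul' le_rfl (mul_le_mul' le_rfl (mul_le_mul' ?_ hq))
            rw [add_assoc]
            exact add_le_add (mul_le_mul' le_rfl (ENNReal.rpow_le_rpow hGK2 (by norm_num)))
              (add_le_add (ENNReal.rpow_le_rpow (hG₀2 hΨm hΨΛ) (by norm_num))
                (ENNReal.rpow_le_rpow (hG₀2 hΨ'm hΨ'Λ) (by norm_num)))
        _ = Mpt * 2⁻¹ ^ (n + 1) := by
            rw [hMpt, pow_succ]
            have h22 : (2 : ℝ≥0∞) * 2⁻¹ = 1 := ENNReal.mul_inv_cancel (by norm_num) (by norm_num)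
            calc _ = μ * (3 * ((2 * gk ^ (1 / 2 : ℝ) + (g0b ^ (1 / 2 : ℝ) + g0b ^ (1 / 2 : ℝ))) * bb)) *
                  (2 * 2⁻¹) * 2⁻¹ ^ n := by rw [h22]; ring
              _ = _ := by ring
        _ ≤ (b₀ + b₀ + Mpt) * 2⁻¹ ^ (n + 1) := mul_le_mul' le_add_self le_rfl


/-- **Geometric decay of the differences of the forced iterates in every weighted sup norm, all
times.** Under the hypotheses of `picard_uniform_bounds_forced'`, for every `K` there is a finite `B`
with `(1+‖ξ‖)^K ‖picardIterForced (n+1) t ξ - picardIterForced n t ξ‖ₑ ≤ B 2^{-n}` for all `n`,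
`t ∈ ℝ`, `ξ` (the pointwise bound of `exists_geometric_weighted_majorant_diff_picardIterForced` at the
clamped time, `e^{λt} ≤ e^{λT}`, `(1+‖ξ‖)^K ≤ (1+‖ξ‖)^{K+2}`).
[cite: Tao2011, Thm. 5.4 (ii) (arXiv Thm. 31); proof of Thm. 5.1 (arXiv Thm. 28, p. 16)] -/
theorem exists_geometric_bound_diff_picardIterForced (hc : 0 < c) (hT : 0 ≤ T)
    (ha : AEStronglyMeasurable a volume)
    (haw : ∀ (k : ℕ) j, ∫⁻ η, (ENNReal.ofReal ((1 + ‖η‖) ^ k) * ‖a η j‖ₑ) ^ 2 < ⊤)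
    (hbm : Measurable (uncurry b)) (hbt : ∀ ξ, Continuous fun s => b s ξ)
    (hbd : ∀ K : ℕ, ∃ B : ℝ, ∀ s, HasDecay K B (b s))
    {δ₁ δ₂ : ℝ≥0∞} (hδ₁ : δ₁ < ⊤) (hδ₂ : δ₂ < ⊤)
    (hα₁ : ∫⁻ η, (ENNReal.ofReal ‖η‖ * ∑ j, ‖a η j‖ₑ) ^ 2 ≤ δ₁)
    (hα₂ : ∫⁻ η, (ENNReal.ofReal (‖η‖ ^ 2) * ∑ j, ‖a η j‖ₑ) ^ 2 ≤ δ₂)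
    (hF₁ : ∀ t ∈ Icc 0 T, ∫⁻ η, (ENNReal.ofReal ‖η‖ * ∑ j, ‖forcing c T b t η j‖ₑ) ^ 2 ≤ δ₁)
    (hG₁ : ∫⁻ t in Ioc 0 T, ∫⁻ η, (ENNReal.ofReal (‖η‖ ^ 2) *
      ∑ j, ‖forcing c T b t η j‖ₑ) ^ 2 ≤ ENNReal.ofReal c⁻¹ * δ₁)
    (hF₂ : ∀ t ∈ Icc 0 T, ∫⁻ η, (ENNReal.ofReal (‖η‖ ^ 2) * ∑ j, ‖forcing c T b t η j‖ₑ) ^ 2 ≤ δ₂)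
    (hG₂ : ∫⁻ t in Ioc 0 T, ∫⁻ η, (ENNReal.ofReal (‖η‖ ^ 3) *
      ∑ j, ‖forcing c T b t η j‖ₑ) ^ 2 ≤ ENNReal.ofReal c⁻¹ * δ₂)
    (hs : 36864 * (ENNReal.ofReal (4 * π) * (Fintype.card (Fin 3) : ℝ≥0∞) ^ 2) ^ 2 *
        ((SNormLESNormFDerivOfEqConst ℂ (volume : Measure (EuclideanSpace ℝ (Fin 3))) 2 *
          ENNReal.ofReal (2 * π)) ^ (3 / 2 : ℝ)) ^ 2 * ENNReal.ofReal c⁻¹ *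
        (ENNReal.ofReal T * ENNReal.ofReal c⁻¹) ^ (1 / 2 : ℝ) * δ₁ ≤ 1) (K : ℕ) :
    ∃ B : ℝ≥0∞, B < ⊤ ∧ ∀ n t ξ, ENNReal.ofReal ((1 + ‖ξ‖) ^ K) *
      ‖picardIterForced c T a b (n + 1) t ξ - picardIterForced c T a b n t ξ‖ₑ ≤ B * 2⁻¹ ^ n := by
  obtain ⟨lam, hlam, bq, -, Bp, hBp, h⟩ :=
    exists_geometric_weighted_majorant_diff_picardIterForced hc hT ha haw hbm hbt hbd hδ₁ hδ₂ hα₁ hα₂ hF₁ hG₁ hF₂ hG₂ hs K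
  refine ⟨ENNReal.ofReal (Real.exp (lam * T)) * Bp, ENNReal.mul_lt_top ENNReal.ofReal_lt_top hBp,
    fun n t ξ => ?_⟩
  obtain ⟨Q, -, -, -, hpt⟩ := h n
  have ht' : clamp T t ∈ Icc 0 T := clamp_mem_Icc hT t
  have h1 := hpt (clamp T t) ht' ξ
  rw [picardIterForced_clamp hT n t, picardIterForced_clamp hT (n + 1) t] at h1
  have hexp : ENNReal.ofReal ((1 + ‖ξ‖) ^ (K + 2)) = ENNReal.ofReal (Real.exp (lam * clamp T t)) *
      ENNReal.ofReal (Real.exp (-lam * clamp T t) * (1 + ‖ξ‖) ^ (K + 2)) := by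
    rw [← ENNReal.ofReal_mul (Real.exp_pos _).le, ← mul_assoc, ← Real.exp_add]
    congr 1
    rw [show lam * clamp T t + -lam * clamp T t = 0 by ring, Real.exp_zero, one_mul]
  have hw : ENNReal.ofReal ((1 + ‖ξ‖) ^ K) ≤ ENNReal.ofReal ((1 + ‖ξ‖) ^ (K + 2)) :=
    ENNReal.ofReal_le_ofReal (pow_le_pow_right₀ (by linarith [norm_nonneg ξ]) (by omega))
  calc ENNReal.ofReal ((1 + ‖ξ‖) ^ K) * ‖picardIterForced c T a b (n + 1) t ξ - picardIterForced c T a b n t ξ‖ₑ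
      ≤ ENNReal.ofReal ((1 + ‖ξ‖) ^ (K + 2)) * ‖picardIterForced c T a b n t ξ - picardIterForced c T a b (n + 1) t ξ‖ₑ := by
        rw [enorm_sub_rev]; exact mul_le_mul' hw le_rfl
    _ = ENNReal.ofReal (Real.exp (lam * clamp T t)) *
        (ENNReal.ofReal (Real.exp (-lam * clamp T t) * (1 + ‖ξ‖) ^ (K + 2)) *
          ‖picardIterForced c T a b n t ξ - picardIterForced c T a b (n + 1) t ξ‖ₑ) := by rw [hexp, mul_assoc]
    _ ≤ ENNReal.ofReal (Real.exp (lam * clamp T t)) * (Bp * 2⁻¹ ^ n) := mul_le_mul' le_rfl h1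
    _ ≤ ENNReal.ofReal (Real.exp (lam * T)) * (Bp * 2⁻¹ ^ n) := by
        refine mul_le_mul' (ENNReal.ofReal_le_ofReal (Real.exp_le_exp.2 ?_)) le_rfl
        exact mul_le_mul_of_nonneg_left ht'.2 hlam.le
    _ = _ := by ring

/-- **Geometric decay of the differences of the forced iterates, real form**: for every `K` there
is `B : ℝ` with `(1+‖ξ‖)^K ‖picardIterForced (n+1) t ξ - picardIterForced n t ξ‖ ≤ B (1/2)^n` for
all `n, t, ξ`. [cite: Tao2011, Thm. 5.4 (ii) (arXiv Thm. 31); proof of Thm. 5.1 (arXiv Thm. 28, p. 16)] -/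
theorem exists_geometric_norm_bound_diff_picardIterForced (hc : 0 < c) (hT : 0 ≤ T)
    (ha : AEStronglyMeasurable a volume)
    (haw : ∀ (k : ℕ) j, ∫⁻ η, (ENNReal.ofReal ((1 + ‖η‖) ^ k) * ‖a η j‖ₑ) ^ 2 < ⊤)
    (hbm : Measurable (uncurry b)) (hbt : ∀ ξ, Continuous fun s => b s ξ)
    (hbd : ∀ K : ℕ, ∃ B : ℝ, ∀ s, HasDecay K B (b s))
    {δ₁ δ₂ : ℝ≥0∞} (hδ₁ : δ₁ < ⊤) (hδ₂ : δ₂ < ⊤)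
    (hα₁ : ∫⁻ η, (ENNReal.ofReal ‖η‖ * ∑ j, ‖a η j‖ₑ) ^ 2 ≤ δ₁)
    (hα₂ : ∫⁻ η, (ENNReal.ofReal (‖η‖ ^ 2) * ∑ j, ‖a η j‖ₑ) ^ 2 ≤ δ₂)
    (hF₁ : ∀ t ∈ Icc 0 T, ∫⁻ η, (ENNReal.ofReal ‖η‖ * ∑ j, ‖forcing c T b t η j‖ₑ) ^ 2 ≤ δ₁)
    (hG₁ : ∫⁻ t in Ioc 0 T, ∫⁻ η, (ENNReal.ofReal (‖η‖ ^ 2) *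
      ∑ j, ‖forcing c T b t η j‖ₑ) ^ 2 ≤ ENNReal.ofReal c⁻¹ * δ₁)
    (hF₂ : ∀ t ∈ Icc 0 T, ∫⁻ η, (ENNReal.ofReal (‖η‖ ^ 2) * ∑ j, ‖forcing c T b t η j‖ₑ) ^ 2 ≤ δ₂)
    (hG₂ : ∫⁻ t in Ioc 0 T, ∫⁻ η, (ENNReal.ofReal (‖η‖ ^ 3) *
      ∑ j, ‖forcing c T b t η j‖ₑ) ^ 2 ≤ ENNReal.ofReal c⁻¹ * δ₂)
    (hs : 36864 * (ENNReal.ofReal (4 * π) * (Fintype.card (Fin 3) : ℝ≥0∞) ^ 2) ^ 2 *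
        ((SNormLESNormFDerivOfEqConst ℂ (volume : Measure (EuclideanSpace ℝ (Fin 3))) 2 *
          ENNReal.ofReal (2 * π)) ^ (3 / 2 : ℝ)) ^ 2 * ENNReal.ofReal c⁻¹ *
        (ENNReal.ofReal T * ENNReal.ofReal c⁻¹) ^ (1 / 2 : ℝ) * δ₁ ≤ 1) (K : ℕ) :
    ∃ B : ℝ, ∀ n t ξ, (1 + ‖ξ‖) ^ K * ‖picardIterForced c T a b (n + 1) t ξ - picardIterForced c T a b n t ξ‖ ≤
      B * (1 / 2) ^ n := by
  obtain ⟨B, hB, h⟩ := exists_geometric_bound_diff_picardIterForced hc hT ha haw hbm hbt hbd hδ₁ hδ₂ hα₁ hα₂ hF₁ hG₁ hF₂ hG₂ hs K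
  refine ⟨B.toReal, fun n t ξ => ?_⟩
  have h1 := h n t ξ
  have hfin : B * 2⁻¹ ^ n ≠ ⊤ :=
    ENNReal.mul_ne_top hB.ne (ENNReal.pow_ne_top (ENNReal.inv_ne_top.2 two_ne_zero))
  rw [← ofReal_norm, ← ENNReal.ofReal_mul (by positivity), ← ENNReal.ofReal_toReal hfin,
    ENNReal.ofReal_le_ofReal_iff ENNReal.toReal_nonneg] at h1
  convert h1 using 1
  rw [ENNReal.toReal_mul, ENNReal.toReal_pow, ENNReal.toReal_inv]
  norm_num

end Differences

end Literature.Analysis.FluidPDE.FourierNS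

end
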